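import Literature.Computability.QuantumComplexity.GaussianRank

/-!
# `NegApproxGaussRankSuperpoly` (stmt-QuantumAdvantage-1245) — negative side II: a tempting
simplification of the line's deficiency stub is FALSE

Line `spectral-mass-flattening` (skeleton `Cruxes/NegApproxGaussRankSuperpoly/Lines/spectral-mass-flattening.lean`),
stub `stub_deficiency`: every degree-`K` Majorana WORD image of an `r`-term Gaussian combination lies
in one subspace of dimension `≤ r · D_K(n)`, `D_K(n) = flatteningDeficiency K n = Σ_{j ≤ K, j ≡ K (2)} C(n,j)`.
The lower-degree terms `j < K` of `D_K` are NOT slack: the stub quantifies over `List`s of labels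
(repetitions allowed), and a word with a repeated letter has lower degree.  This file records the
minimal witness so that no stub worker tries to prove the bound with `C(n,K)` in place of `D_K(n)`.
(refuter-cdisprove-stmt-QuantumAdvantage-1245-0, generation 1, 2026-08-16; from the work file
`Cruxes/NegApproxGaussRankSuperpoly/Disproof.lean` §4b.)  Sorry-free.
-/

noncomputable section

set_option linter.dupNamespace false -- D-0017: single-conjunct summit ⇒ `QuantumAdvantage.QuantumAdvantage` by design

namespace Summit.QuantumAdvantage.QuantumAdvantage.Theorems.NegApproxGaussRankSuperpoly.Negative

open Literature.Computability.Cryptography Literature.Computability.QuantumComplexity Matrix Finset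

/-- One cannot replace the deficiency `D_K(n) = Σ_{j ≤ K, j ≡ K (2)} C(n,j)` in `stub_deficiency`
by its top term `C(n,K)`: words with REPEATED letters (allowed by the stub's `List` signature) land
in LOWER degrees.  Witness `n = 1, K = 2, r = 1`: `c_X c_X |0⟩ = |0⟩ ≠ 0` would have to lie in a
subspace of dimension `≤ C(1,2) = 0`.  (For repetition-free words the top-term bound fails too,
from `n = 2` on: `span{c_S |00⟩ : |S| = 2} ∋ |00⟩, |11⟩`.) [folklore] -/
theorem not_deficiency_topDegreeOnly :
    ¬ (∀ (n K r : ℕ) (a : Fin r → ℂ) (g : Fin r → QReg n → ℂ), (∀ i, IsGaussian (g i)) →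
        ∃ W : Submodule ℂ (QReg n → ℂ), Module.finrank ℂ W ≤ r * n.choose K ∧
          ∀ l : List (Fin n × Bool), l.length = K →
            (l.map fun p => majorana n p.1 p.2).prod *ᵥ (∑ i, a i • g i) ∈ W) := by
  intro h
  obtain ⟨W, hW, hmem⟩ := h 1 2 1 (fun _ => 1) (fun _ => basisState (fun _ => false))
    (fun _ => basisState_isGaussian _)
  have hW0 : W = ⊥ := by
    rw [← Submodule.finrank_eq_zero]
    have h12 : Nat.choose 1 2 = 0 := by decide
    rw [h12, mul_zero] at hW
    omega
  have key := hmem [((0 : Fin 1), false), ((0 : Fin 1), false)] rfl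
  rw [hW0, Submodule.mem_bot] at key
  simp only [List.map_cons, List.map_nil, List.prod_cons, List.prod_nil, mul_one,
    majorana_mul_self, Fin.sum_univ_one, one_smul, Matrix.one_mulVec] at key
  exact basisState_ne_zero _ key

end Summit.QuantumAdvantage.QuantumAdvantage.Theorems.NegApproxGaussRankSuperpoly.Negative

end
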